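import Mathlib
import HarnessLib
import Literature.MathematicalPhysics.StatisticalMechanics.PolymerExpansion
import Literature.MathematicalPhysics.StatisticalMechanics.RelevantHamiltonians

/-!
# The renormalisation step `T_k`: the reblocked perturbation `K_{k+1}` and the identity
# `R_{k+1}(e^{−H_k} ∘ K_k)(Λ) = (e^{−H_{k+1}} ∘ K_{k+1})(Λ)` ([ABKM19] Definition 6.5, Proposition 6.6)

Adams–Buchholz–Kotecký–Müller define the renormalisation transformation
`T_k : (H_k, K_k) ↦ (H_{k+1}, K_{k+1})` of a gradient model on the torus `Λ = (ℤ/L^N)^d` by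
(i) choosing a next-scale relevant Hamiltonian `H̃_k(B)` per `k`-block (in the source
`H̃_k = Π₂R_{k+1}H_k − Π₂R_{k+1}K_k`, (6.16)); (ii) the algebraic rewriting (6.31)
`I ∘ K = Ĩ ∘ (J̃ ∘ (I − 1) ∘ K)`, `I = e^{−H_k}(φ+ξ)`, `Ĩ = e^{−H̃_k}(φ)`, `J̃ = 1 − Ĩ`, which
isolates the `ξ`-independent factor `Ĩ`; (iii) integrating the fluctuation field `ξ` against
`μ_{k+1}`; (iv) REBLOCKING: regrouping the sum over `k`-polymers `X` according to the
`(k+1)`-polymer `U = π(X)` they are attributed to ((6.32)–(6.34)).  The outcome is the identity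
(6.13)/(6.40), `∫ (e^{−H_k} ∘ K_k)(Λ, φ+ξ) μ_{k+1}(dξ) = (e^{−H_{k+1}} ∘ K_{k+1})(Λ, φ)` with
`H_{k+1}(B') = Σ_{B ∈ 𝓑_k(B')} H̃_k(B)`.

This file formalises steps (ii)–(iv) and Proposition 6.6 in the generality in which they hold:
for ANY one-block functionals `I` (evaluated at `φ + ξ`) and `Ĩ` (evaluated at `φ`, non-vanishing),
ANY polymer functional `K`, ANY finite measure `μ` on fields and ANY reblocking map `π` sending
`k`-polymers to `(k+1)`-polymers — the identity is pure polymer algebra plus the exchange of a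
finite sum with the integral; neither the choice `H̃ = Π₂(…)` nor the specific `π` of the source
nor the finite range of `μ_{k+1}` enter (those matter for the PROPERTIES of `K_{k+1}`, Lemma 6.4,
not for the identity).

* `midK s I Ĩ K X φ ξ` — the intermediate functional `Φ(X, φ, ξ) = (J̃ ∘ ((I−1) ∘ K))(X)` (6.32);
* `pcirc_bprod_eq_pcirc_midK` — (6.31): `(I ∘ K)(W) = (Ĩ ∘ Φ)(W)` on every `k`-polymer `W`;
* `sum_reblock` — (6.32)–(6.33): `Σ_X Ĩ^{Λ∖X} G(X) = Σ_U Ĩ^{Λ∖U} Σ_{π X = U} Ĩ^{U∖X} Ĩ^{−(X∖U)} G(X)`;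
* `nextK s L π μ I Ĩ K U φ` — **`K_{k+1}(U, φ)`** of (6.34);
* `midK_eq_sum`, `integrable_midK` — `Φ(X, φ, ·)` is a finite combination of
  `ξ ↦ I^{Z}(φ+ξ) K(Y, φ+ξ)`, hence integrable when these are;
* **`integral_pcirc_eq_pcirc_nextK`** — Proposition 6.6:
  `∫ (I^∘(φ+ξ) ∘ K(φ+ξ))(Λ) dμ(ξ) = (K_{k+1}(φ) ∘_{k+1} Ĩ^∘(φ))(Λ)`, the right-hand side a
  scale-`(k+1)` circle product whose block factor `Ĩ^{U}` (a `k`-block product over the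
  `(k+1)`-polymer `U`) equals `∏_{B' ∈ 𝓑_{k+1}(U)} ∏_{B ∈ 𝓑_k(B')} Ĩ(B)`
  (`TorusPolymer.bprod_eq_bprod_mul`), i.e. `e^{−H_{k+1}}` with `H_{k+1}(B') = Σ_B H̃(B)`;
* the exponential instance (`𝕜 = ℂ`): `bprod_cexp_neg_eval` — `(e^{−H})^X = e^{−H(X)}` for a
  relevant Hamiltonian (`eval` is additive over the blocks of a polymer), so that with
  `I = e^{−H_k(·)(φ+ξ)}`, `Ĩ = e^{−H̃(·)(φ)}` the theorem reads literally as (6.40) with (6.34):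
  `integral_pcirc_cexp_eq`.

Everything is proved; no named fact.  What is NOT here: the source's specific `π` (lexicographic
choice on small polymers, `X̄` on large connected ones, componentwise extension (6.26)) and the
properties of `K_{k+1}` it yields (Lemma 6.4: translation invariance, locality, factorisation over
strictly disjoint polymers — the last one is where the finite range of `μ_{k+1}` enters); the
linearisation (Theorem 6.8); norms.

## References
* S. Adams, S. Buchholz, R. Kotecký, S. Müller, *Cauchy–Born rule from microscopic models with
  non-convex potentials*, arXiv:1910.13564, Ch. 6.3: (6.13), (6.16)–(6.18), (6.29)–(6.34),
  Definition 6.5, Proposition 6.6 [AdamsBuchholzKoteckyMuller2019].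
-/

noncomputable section

namespace Literature.MathematicalPhysics.StatisticalMechanics.GradientRG

open scoped BigOperators Classical
open Finset MeasureTheory
open Literature.MathematicalPhysics.StatisticalMechanics.TorusPolymer

variable {d M : ℕ} [NeZero M] {𝕜 : Type*} [RCLike 𝕜]

/-! ## The intermediate functional `Φ` and the rewriting (6.31) -/

/-- **`Φ(X, φ, ξ) = (J̃(φ) ∘ ((I(φ+ξ) − 1) ∘ K(φ+ξ)))(X)`** ([ABKM19] (6.32)), for one-block
functionals `I, Ĩ` (`J̃ = 1 − Ĩ`) and a polymer functional `K`, all scalar-valued at the given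
fields; circle products at scale `k` (block side `s = L^k`).
[cite: AdamsBuchholzKoteckyMuller2019, Ch. 6.3 (6.32)] -/
def midK (s : ℕ) (I It : Finset (Fin d → ZMod M) → ((Fin d → ZMod M) → ℝ) → 𝕜)
    (K : Finset (Fin d → ZMod M) → ((Fin d → ZMod M) → ℝ) → 𝕜) (X : Finset (Fin d → ZMod M))
    (φ ξ : (Fin d → ZMod M) → ℝ) : 𝕜 :=
  pcirc s (bprod s fun B => 1 - It B φ)
    (pcirc s (bprod s fun B => I B (φ + ξ) - 1) fun Y => K Y (φ + ξ)) X

/-- `Φ(∅, φ, ξ) = K(∅, φ+ξ)`. [cite: AdamsBuchholzKoteckyMuller2019, Ch. 6.3 (6.32)] -/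
@[simp] theorem midK_empty (s : ℕ) (I It K : Finset (Fin d → ZMod M) → ((Fin d → ZMod M) → ℝ) → 𝕜)
    (φ ξ : (Fin d → ZMod M) → ℝ) : midK s I It K ∅ φ ξ = K ∅ (φ + ξ) := by
  simp [midK]

/-- **(6.31): `(I ∘ K)(W) = (Ĩ ∘ Φ)(W)`** on every `k`-polymer `W`, from
`I = Ĩ ∘ ((1 − Ĩ) ∘ (I − 1))` (binomial expansion over blocks, twice) and associativity.
[cite: AdamsBuchholzKoteckyMuller2019, Ch. 6.3 (6.31)] -/
theorem pcirc_bprod_eq_pcirc_midK {s : ℕ} (I It K : Finset (Fin d → ZMod M) → ((Fin d → ZMod M) → ℝ) → 𝕜)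
    {W : Finset (Fin d → ZMod M)} (hW : IsPolymer s W) (φ ξ : (Fin d → ZMod M) → ℝ) :
    pcirc s (bprod s fun B => I B (φ + ξ)) (fun Y => K Y (φ + ξ)) W
      = pcirc s (bprod s fun B => It B φ) (fun X => midK s I It K X φ ξ) W := by
  rw [pcirc_congr_left (fun Y => K Y (φ + ξ)) (F' := pcirc s (bprod s fun B => It B φ)
      (pcirc s (bprod s fun B => 1 - It B φ) (bprod s fun B => I B (φ + ξ) - 1)))
      (fun Y hY _ => bprod_eq_pcirc_three _ _ hY)]
  rw [pcirc_assoc]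
  refine pcirc_congr_right _ hW fun Y _ _ => ?_
  rw [pcirc_assoc]
  rfl

/-! ## Reblocking: regrouping by `U = π(X)` ((6.32)–(6.33)) -/

/-- The unit identity behind (6.32): `Ĩ^{Λ∖X} Ĩ^{X∖U} = Ĩ^{Λ∖U} Ĩ^{U∖X}` for `k`-polymers `X, U`
(both sides are `Ĩ^{Λ ∖ (X ∩ U)}`, by `(Λ∖X) ⊔ (X∖U) = Λ∖(X∩U) = (Λ∖U) ⊔ (U∖X)`).
[cite: AdamsBuchholzKoteckyMuller2019, Ch. 6.3 (6.30)] -/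
theorem bprod_sdiff_mul_bprod_sdiff {s : ℕ} (F : Finset (Fin d → ZMod M) → 𝕜)
    {X U : Finset (Fin d → ZMod M)} (hX : IsPolymer s X) (hU : IsPolymer s U) :
    bprod s F (univ \ X) * bprod s F (X \ U) = bprod s F (univ \ U) * bprod s F (U \ X) := by
  have hΛ : IsPolymer s (univ : Finset (Fin d → ZMod M)) := isPolymer_univ s
  rw [← bprod_union F (hΛ.sdiff hX) (hX.sdiff hU)
      (disjoint_of_subset_right sdiff_subset sdiff_disjoint),
    ← bprod_union F (hΛ.sdiff hU) (hU.sdiff hX)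
      (disjoint_of_subset_right sdiff_subset sdiff_disjoint)]
  congr 1
  ext x
  simp only [mem_union, mem_sdiff, mem_univ, true_and]
  tauto

/-- **Reblocking (6.32)–(6.33)**: for a map `π` sending `k`-polymers to `(Ls)`-polymers
(`s, L` odd, so these are `k`-polymers too) and a non-vanishing one-block functional `Ĩ`,
`Σ_{X ∈ 𝓟_k} Ĩ^{Λ∖X} G(X) = Σ_{U ∈ 𝓟_{k+1}} Ĩ^{Λ∖U} Σ_{X : π(X) = U} Ĩ^{U∖X} (Ĩ^{X∖U})⁻¹ G(X)`.
[cite: AdamsBuchholzKoteckyMuller2019, Ch. 6.3 (6.33)] -/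
theorem sum_reblock {s L : ℕ} (hs : Odd s) (hL : Odd L) {π : Finset (Fin d → ZMod M) → Finset (Fin d → ZMod M)}
    (hπ : ∀ X, IsPolymer s X → IsPolymer (L * s) (π X)) {F : Finset (Fin d → ZMod M) → 𝕜}
    (hF : ∀ B, F B ≠ 0) (G : Finset (Fin d → ZMod M) → 𝕜) :
    ∑ X ∈ polys s univ, bprod s F (univ \ X) * G X
      = ∑ U ∈ polys (L * s) univ, bprod s F (univ \ U) *
          ∑ X ∈ (polys s univ).filter (fun X => π X = U),
            bprod s F (U \ X) * (bprod s F (X \ U))⁻¹ * G X := by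
  symm
  calc ∑ U ∈ polys (L * s) univ, bprod s F (univ \ U) *
          ∑ X ∈ (polys s univ).filter (fun X => π X = U),
            bprod s F (U \ X) * (bprod s F (X \ U))⁻¹ * G X
      = ∑ U ∈ polys (L * s) univ, ∑ X ∈ (polys s univ).filter (fun X => π X = U),
          bprod s F (univ \ π X) * (bprod s F (π X \ X) * (bprod s F (X \ π X))⁻¹ * G X) := by
        refine Finset.sum_congr rfl fun U _ => ?_
        rw [Finset.mul_sum]
        refine Finset.sum_congr rfl fun X hX => ?_
        rw [(Finset.mem_filter.1 hX).2]
    _ = ∑ X ∈ polys s univ,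
          bprod s F (univ \ π X) * (bprod s F (π X \ X) * (bprod s F (X \ π X))⁻¹ * G X) :=
        Finset.sum_fiberwise_of_maps_to (g := π)
          (fun X hX => mem_polys.2 ⟨subset_univ _, hπ X (mem_polys.1 hX).2⟩) _
    _ = ∑ X ∈ polys s univ, bprod s F (univ \ X) * G X := by
        refine Finset.sum_congr rfl fun X hX => ?_
        have hXp : IsPolymer s X := (mem_polys.1 hX).2
        have hUp : IsPolymer s (π X) := (hπ X hXp).of_mul hs hL
        have hne : bprod s F (X \ π X) ≠ 0 := prod_ne_zero_iff.2 fun B _ => hF B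
        have key := bprod_sdiff_mul_bprod_sdiff F hXp hUp
        field_simp
        linear_combination G X * key.symm

/-! ## The next-scale perturbation `K_{k+1}` (6.34) -/

/-- **`K_{k+1}(U, φ)`** ([ABKM19] (6.34)): for a `(k+1)`-polymer `U`,
`K_{k+1}(U, φ) = Σ_{X ∈ 𝓟_k, π(X) = U} Ĩ^{U∖X}(φ) (Ĩ^{X∖U}(φ))⁻¹ ∫ Φ(X, φ, ξ) μ_{k+1}(dξ)`
(with `Ĩ = e^{−H̃_k}` the prefactor is `exp(−Σ_{B ∈ 𝓑_k(U∖X)} H̃_k(B,φ) + Σ_{B ∈ 𝓑_k(X∖U)} H̃_k(B,φ))`).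
Data: block side `s = L^k`, ratio `L`, reblocking map `π`, fluctuation measure `μ = μ_{k+1}`,
one-block functionals `I = e^{−H_k}`, `Ĩ = e^{−H̃_k}`, the perturbation `K = K_k`.
[cite: AdamsBuchholzKoteckyMuller2019, Definition 6.5 (6.34)] -/
def nextK (s : ℕ) (π : Finset (Fin d → ZMod M) → Finset (Fin d → ZMod M))
    (μ : Measure ((Fin d → ZMod M) → ℝ))
    (I It K : Finset (Fin d → ZMod M) → ((Fin d → ZMod M) → ℝ) → 𝕜)
    (U : Finset (Fin d → ZMod M)) (φ : (Fin d → ZMod M) → ℝ) : 𝕜 :=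
  ∑ X ∈ (polys s univ).filter (fun X => π X = U),
    bprod s (fun B => It B φ) (U \ X) * (bprod s (fun B => It B φ) (X \ U))⁻¹ *
      ∫ ξ, midK s I It K X φ ξ ∂μ

/-! ## Integrability of `Φ(X, φ, ·)` -/

/-- `(I − 1)^Z = Σ_{W ∈ 𝓟_k(Z)} (−1)^{|𝓑_k(Z∖W)|} I^{W}` (binomial expansion over blocks).
[cite: AdamsBuchholzKoteckyMuller2019, Ch. 6.2 (6.20)] -/
theorem bprod_sub_one_eq_sum {s : ℕ} (F : Finset (Fin d → ZMod M) → 𝕜) {Z : Finset (Fin d → ZMod M)}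
    (hZ : IsPolymer s Z) :
    bprod s (fun B => F B - 1) Z
      = ∑ W ∈ polys s Z, (-1 : 𝕜) ^ (blocks s (Z \ W)).card * bprod s F W := by
  have h := pcirc_bprod_bprod F (fun _ => (-1 : 𝕜)) hZ
  simp only [← sub_eq_add_neg] at h
  rw [← h, pcirc]
  refine Finset.sum_congr rfl fun W _ => ?_
  rw [bprod, bprod, prod_const, mul_comm]

/-- **Expansion of `Φ`**: `Φ(X, φ, ξ) = Σ_{Y} Σ_{Z} Σ_{W} J̃^{Y}(φ) (−1)^{|𝓑_k(Z∖W)|} ·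
I^{W}(φ+ξ) K(X∖Y∖Z, φ+ξ)` over `Y ∈ 𝓟_k(X)`, `Z ∈ 𝓟_k(X∖Y)`, `W ∈ 𝓟_k(Z)`.
[cite: AdamsBuchholzKoteckyMuller2019, Ch. 6.3 (6.32)] -/
theorem midK_eq_sum {s : ℕ} (I It K : Finset (Fin d → ZMod M) → ((Fin d → ZMod M) → ℝ) → 𝕜)
    (X : Finset (Fin d → ZMod M)) (φ ξ : (Fin d → ZMod M) → ℝ) :
    midK s I It K X φ ξ
      = ∑ Y ∈ polys s X, ∑ Z ∈ polys s (X \ Y), ∑ W ∈ polys s Z,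
          (bprod s (fun B => 1 - It B φ) Y * (-1 : 𝕜) ^ (blocks s (Z \ W)).card) *
            (bprod s (fun B => I B (φ + ξ)) W * K ((X \ Y) \ Z) (φ + ξ)) := by
  unfold midK pcirc
  refine Finset.sum_congr rfl fun Y hY => ?_
  rw [Finset.mul_sum]
  refine Finset.sum_congr rfl fun Z hZ => ?_
  rw [bprod_sub_one_eq_sum _ (mem_polys.1 hZ).2, Finset.sum_mul, Finset.mul_sum]
  exact Finset.sum_congr rfl fun W _ => by ring

/-- **`Φ(X, φ, ·)` is integrable** when every `ξ ↦ I^{Z}(φ+ξ) K(Y, φ+ξ)` (`Y, Z` `k`-polymers) is.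
[cite: AdamsBuchholzKoteckyMuller2019, Ch. 6.3 (6.32)] -/
theorem integrable_midK {s : ℕ} {I It K : Finset (Fin d → ZMod M) → ((Fin d → ZMod M) → ℝ) → 𝕜}
    {μ : Measure ((Fin d → ZMod M) → ℝ)} {φ : (Fin d → ZMod M) → ℝ}
    (hint : ∀ Z Y, IsPolymer s Z → IsPolymer s Y →
      Integrable (fun ξ => bprod s (fun B => I B (φ + ξ)) Z * K Y (φ + ξ)) μ)
    {X : Finset (Fin d → ZMod M)} (hX : IsPolymer s X) :
    Integrable (fun ξ => midK s I It K X φ ξ) μ := by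
  simp_rw [midK_eq_sum I It K X φ]
  refine integrable_finsetSum _ fun Y hY => integrable_finsetSum _ fun Z hZ =>
    integrable_finsetSum _ fun W hW => Integrable.const_mul ?_ _
  have hYp := (mem_polys.1 hY).2
  have hZp := (mem_polys.1 hZ).2
  exact hint W ((X \ Y) \ Z) (mem_polys.1 hW).2 ((hX.sdiff hYp).sdiff hZp)

/-! ## Proposition 6.6 -/

/-- **Proposition 6.6 / (6.13), generic form.**  For odd `s, L`, a reblocking map `π` with
`π(X) ∈ 𝓟_{k+1}` for `X ∈ 𝓟_k`, a non-vanishing one-block functional `Ĩ(·, φ)`, and integrable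
`ξ ↦ I^{Z}(φ+ξ) K(Y, φ+ξ)`:
`∫ (I^∘(φ+ξ) ∘ K(φ+ξ))(Λ) μ(dξ) = (K_{k+1}(·, φ) ∘_{k+1} Ĩ^∘(φ))(Λ)`
`= Σ_{U ∈ 𝓟_{k+1}} K_{k+1}(U, φ) Ĩ^{Λ∖U}(φ)`, with `K_{k+1} = nextK` of (6.34).  Here
`Ĩ^{Λ∖U} = ∏_{B' ∈ 𝓑_{k+1}(Λ∖U)} ∏_{B ∈ 𝓑_k(B')} Ĩ(B)` (`TorusPolymer.bprod_eq_bprod_mul`) is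
`e^{−H_{k+1}}(Λ∖U)` for `H_{k+1}(B') = Σ_{B ∈ 𝓑_k(B')} H̃_k(B)` when `Ĩ = e^{−H̃_k}`.
[cite: AdamsBuchholzKoteckyMuller2019, Proposition 6.6] -/
theorem integral_pcirc_eq_pcirc_nextK {s L : ℕ} (hs : Odd s) (hL : Odd L)
    {π : Finset (Fin d → ZMod M) → Finset (Fin d → ZMod M)}
    (hπ : ∀ X, IsPolymer s X → IsPolymer (L * s) (π X))
    (μ : Measure ((Fin d → ZMod M) → ℝ))
    {I It K : Finset (Fin d → ZMod M) → ((Fin d → ZMod M) → ℝ) → 𝕜} {φ : (Fin d → ZMod M) → ℝ}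
    (hIt : ∀ B, It B φ ≠ 0)
    (hint : ∀ Z Y, IsPolymer s Z → IsPolymer s Y →
      Integrable (fun ξ => bprod s (fun B => I B (φ + ξ)) Z * K Y (φ + ξ)) μ) :
    ∫ ξ, pcirc s (bprod s fun B => I B (φ + ξ)) (fun Y => K Y (φ + ξ)) univ ∂μ
      = pcirc (L * s) (fun U => nextK s π μ I It K U φ) (bprod s fun B => It B φ) univ := by
  have hΛ : IsPolymer s (univ : Finset (Fin d → ZMod M)) := isPolymer_univ s
  -- (6.31) under the integral, then exchange the finite sum with the integral
  have h1 : ∫ ξ, pcirc s (bprod s fun B => I B (φ + ξ)) (fun Y => K Y (φ + ξ)) univ ∂μ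
      = ∑ X ∈ polys s univ, bprod s (fun B => It B φ) (univ \ X) * ∫ ξ, midK s I It K X φ ξ ∂μ := by
    simp_rw [pcirc_bprod_eq_pcirc_midK I It K hΛ φ, pcirc_apply_symm _ _ hΛ]
    rw [integral_finsetSum]
    · exact Finset.sum_congr rfl fun X _ => integral_const_mul _ _
    · intro X hX
      exact (integrable_midK hint (mem_polys.1 hX).2).const_mul _
  rw [h1, sum_reblock hs hL hπ hIt, pcirc]
  exact Finset.sum_congr rfl fun U _ => by rw [nextK, mul_comm]

/-! ## The exponential instance: `I = e^{−H_k}`, `Ĩ = e^{−H̃_k}` (`𝕜 = ℂ`) -/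

/-- `H(X, φ) = Σ_{B ∈ 𝓑_k(X)} H(B, φ)` for a `k`-polymer `X`.
[cite: AdamsBuchholzKoteckyMuller2019, Ch. 6.2] -/
theorem eval_eq_sum_blocks {𝕜' : Type*} [CommRing 𝕜'] [Algebra ℝ 𝕜'] {s : ℕ}
    (H : RelevantHamiltonian 𝕜' d) {X : Finset (Fin d → ZMod M)} (hX : IsPolymer s X)
    (φ : (Fin d → ZMod M) → ℝ) : eval H X φ = ∑ B ∈ blocks s X, eval H B φ := by
  conv_lhs => rw [← hX.biUnion_blocks]
  rw [eval, Finset.sum_biUnion (pairwiseDisjoint_blocks s X)]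
  rfl

/-- **`(e^{−H})^X = e^{−H(X)}`** for a relevant Hamiltonian on a `k`-polymer `X`: the block
products of `B ↦ exp(−H(B, φ))` multiply up because `H(X, φ) = Σ_{B ∈ 𝓑_k(X)} H(B, φ)`.
[cite: AdamsBuchholzKoteckyMuller2019, Ch. 6.3 (6.18)] -/
theorem bprod_cexp_neg_eval {s : ℕ} (H : RelevantHamiltonian ℂ d) {X : Finset (Fin d → ZMod M)}
    (hX : IsPolymer s X) (φ : (Fin d → ZMod M) → ℝ) :
    bprod s (fun B => Complex.exp (-(eval H B φ))) X = Complex.exp (-(eval H X φ)) := by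
  rw [bprod, ← Complex.exp_sum]
  congr 1
  rw [Finset.sum_neg_distrib, eval_eq_sum_blocks H hX φ]

/-- **Proposition 6.6 as printed** ((6.40) with (6.34), `𝕜 = ℂ`): for relevant Hamiltonians
`H = H_k` and `H̃ = H̃_k` (any choice), a perturbation `K = K_k`, a finite fluctuation measure
`μ = μ_{k+1}` making `ξ ↦ e^{−H(Z, φ+ξ)} K(Y, φ+ξ)` integrable, and a reblocking map `π`:
`∫ (e^{−H} ∘ K)(Λ, φ + ξ) μ(dξ) = Σ_{U ∈ 𝓟_{k+1}} K_{k+1}(U, φ) · e^{−H̃(Λ∖U, φ)}`, where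
`e^{−H̃(Λ∖U, φ)} = ∏_{B' ∈ 𝓑_{k+1}(Λ∖U)} e^{−H_{k+1}(B', φ)}`, `H_{k+1}(B') = Σ_{B ∈ 𝓑_k(B')} H̃(B)`
(`= H̃(B')`, `eval_eq_sum_blocks`), i.e. the right-hand side is `(e^{−H_{k+1}} ∘ K_{k+1})(Λ, φ)`.
[cite: AdamsBuchholzKoteckyMuller2019, Proposition 6.6] -/
theorem integral_pcirc_cexp_eq {s L : ℕ} (hs : Odd s) (hL : Odd L)
    {π : Finset (Fin d → ZMod M) → Finset (Fin d → ZMod M)}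
    (hπ : ∀ X, IsPolymer s X → IsPolymer (L * s) (π X))
    (μ : Measure ((Fin d → ZMod M) → ℝ)) (H Ht : RelevantHamiltonian ℂ d)
    {K : Finset (Fin d → ZMod M) → ((Fin d → ZMod M) → ℝ) → ℂ} {φ : (Fin d → ZMod M) → ℝ}
    (hint : ∀ Z Y, IsPolymer s Z → IsPolymer s Y →
      Integrable (fun ξ => Complex.exp (-(eval H Z (φ + ξ))) * K Y (φ + ξ)) μ) :
    ∫ ξ, pcirc s (fun Z => Complex.exp (-(eval H Z (φ + ξ)))) (fun Y => K Y (φ + ξ)) univ ∂μ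
      = ∑ U ∈ polys (L * s) univ,
          nextK s π μ (fun B ψ => Complex.exp (-(eval H B ψ))) (fun B ψ => Complex.exp (-(eval Ht B ψ)))
            K U φ * Complex.exp (-(eval Ht (univ \ U) φ)) := by
  have hΛ : IsPolymer s (univ : Finset (Fin d → ZMod M)) := isPolymer_univ s
  have h := integral_pcirc_eq_pcirc_nextK hs hL hπ μ
    (I := fun B ψ => Complex.exp (-(eval H B ψ))) (It := fun B ψ => Complex.exp (-(eval Ht B ψ)))
    (K := K) (φ := φ) (fun B => Complex.exp_ne_zero _) ?_
  · have hl : ∀ ξ, pcirc s (fun Z => Complex.exp (-(eval H Z (φ + ξ)))) (fun Y => K Y (φ + ξ)) univ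
        = pcirc s (bprod s fun B => Complex.exp (-(eval H B (φ + ξ)))) (fun Y => K Y (φ + ξ)) univ :=
      fun ξ => pcirc_congr_left _ fun Z hZ _ => (bprod_cexp_neg_eval H hZ (φ + ξ)).symm
    simp_rw [hl]
    rw [h, pcirc]
    refine Finset.sum_congr rfl fun U hU => ?_
    rw [bprod_cexp_neg_eval Ht (hΛ.sdiff ((mem_polys.1 hU).2.of_mul hs hL)) φ]
  · intro Z Y hZ hY
    simp_rw [bprod_cexp_neg_eval H hZ]
    exact hint Z Y hZ hY

end Literature.MathematicalPhysics.StatisticalMechanics.GradientRG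

end
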